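import Summits.CriticalPhenomena.PercolationContinuityZ3.Theorems.PercNearOneGluingNoHeavyLowerTailSunflowerBipartiteSafe
import Mathlib.Combinatorics.SimpleGraph.Bipartite
import Mathlib.Combinatorics.SimpleGraph.Acyclic
import HarnessLib

/-!
# `NoHeavyLowerTail` (crux stmt-CriticalPhenomena-4575), abstract sunflower cubic: BIPARTITE GRAPH CORES ARE A-SAFE — part 5: corollaries
# in Mathlib's vocabulary (`SimpleGraph.IsBipartite`, forests, trees)

Support file (seat `prim-ineq-prove-1` gen 40; `--supports stmt-CriticalPhenomena-4575`).  No `sorry`, no named facts.  Memo: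
run/shared/lean/prim/prim-ineq-prove-1/FINDING-BIPARTITE-prove1-g40.md.

From `Bridge.safe_edgeCore_of_bipartite` (file `…SunflowerBipartiteSafe`): `safe_edgeCore_of_isBipartite` (a 2-colouring gives the side
`L = {v | C v = 0}`), `safe_edgeCore_of_isAcyclic`, `safe_edgeCore_of_isTree` (Mathlib's `IsAcyclic.colorable_two`,
`IsTree.colorable_two`), and the closed statement `triangleFreeSafe_bipartite : ∀ n Γ, Γ.IsBipartite → ∀ p, Safe p (edgeCore Γ)` — the
bipartite half of g39's conjecture `SafeCalc.TriangleFreeSafe` (the other direction of the characterisation, "a triangle kills safety",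
is `SafeCalc.not_aSafe_of_triangle`; open: non-bipartite triangle-free graphs).
-/
/-! ### Corollaries: Mathlib's `IsBipartite` / forests / trees -/

namespace Summit.CriticalPhenomena.PercolationContinuityZ3.Theorems.SunflowerPartition

namespace Bridge

open Finset

variable {n : ℕ}

/-- **Every bipartite graph (`SimpleGraph.IsBipartite`, i.e. 2-colourable) has a safe graph core for every parameter vector** —
g39's conjecture `SafeCalc.TriangleFreeSafe` on the bipartite stratum. [this work] -/
theorem safe_edgeCore_of_isBipartite (Γ : SimpleGraph (Fin n)) (hΓ : Γ.IsBipartite) (p : Fin n → unitInterval) :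
    SafeCalc.Safe p (SafeCalc.edgeCore Γ) := by
  classical
  obtain ⟨C⟩ := hΓ
  refine safe_edgeCore_of_bipartite Γ (univ.filter fun v => C v = 0) (fun u v huv => ?_) p
  have hne : C u ≠ C v := C.valid huv
  simp only [Finset.mem_filter, Finset.mem_univ, true_and]
  constructor
  · intro hu hv; exact hne (hu.trans hv.symm)
  · intro hv
    rcases Fin.eq_zero_or_eq_succ (C u) with hu | ⟨j, hj⟩
    · exact hu
    · exfalso
      have hj0 : j = 0 := Fin.eq_zero j
      subst hj0
      rcases Fin.eq_zero_or_eq_succ (C v) with hv0 | ⟨j', hj'⟩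
      · exact hv hv0
      · have : j' = 0 := Fin.eq_zero j'
        subst this
        exact hne (hj.trans hj'.symm)

/-- Forests (acyclic graphs) have safe graph cores for every parameter vector. [this work] -/
theorem safe_edgeCore_of_isAcyclic (Γ : SimpleGraph (Fin n)) (hΓ : Γ.IsAcyclic) (p : Fin n → unitInterval) :
    SafeCalc.Safe p (SafeCalc.edgeCore Γ) :=
  safe_edgeCore_of_isBipartite Γ hΓ.colorable_two p

/-- Trees have safe graph cores for every parameter vector. [this work] -/
theorem safe_edgeCore_of_isTree (Γ : SimpleGraph (Fin n)) (hΓ : Γ.IsTree) (p : Fin n → unitInterval) :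
    SafeCalc.Safe p (SafeCalc.edgeCore Γ) :=
  safe_edgeCore_of_isBipartite Γ hΓ.colorable_two p

/-- The bipartite half of `SafeCalc.TriangleFreeSafe`, as a closed statement. [this work] -/
theorem triangleFreeSafe_bipartite :
    ∀ (n : ℕ) (Γ : SimpleGraph (Fin n)), Γ.IsBipartite → ∀ p : Fin n → unitInterval, SafeCalc.Safe p (SafeCalc.edgeCore Γ) :=
  fun _ Γ hΓ p => safe_edgeCore_of_isBipartite Γ hΓ p

end Bridge

end Summit.CriticalPhenomena.PercolationContinuityZ3.Theorems.SunflowerPartition
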